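import Summits.RiemannHypothesis.RiemannHypothesis.Theorems.SpectralTraceSpectralThesisStubClosedLadder
import HarnessLib

/-!
# Crux `WindowStep` (stmt-RiemannHypothesis-14659), line `conjugate-point` — stub `stub_traceLimit`

The COMPACTNESS half of "the set of trace levels is closed under suprema" (RH-free): given, for
every level `B < A`, SOME real family `γ` reproducing the Weil functional `W` on the Weil tests
supported in `[-B, B]`, there is ONE real family serving every level `B < A` simultaneously.

Proof. Choose levels `a_k ↑ A` with `A/2 ≤ a_k < A` (`exists_levels`) and families `γ^k` at the
levels `a_k`. All of them are families for the FIXED window `[-A/2, A/2]`, so the honest cell-wise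
selection argument already in the tree applies verbatim:
`SpectralThesis.Sketch.ClosedLadder.exists_limit_family` (uniform local Weyl law
`#{i : |γ^k_i - T| ≤ 1} ≤ C (1 + log (1 + |T|))` with ONE constant for all `k`, integer cells with
eventually constant counts and convergent positions along the free ultrafilter `hyperfilter ℕ`,
limit family on `Σ n : ℤ, Fin (c n)`, identification by Tannery's theorem with the cell decay of
`ĝ`). It returns one family `γ'` such that every identity `HasSum (i ↦ ĝ(1/2 + iγ^k_i)) a` valid
for all large `k` passes to `γ'`. For a test `g` supported in `[-B, B]` with `B < A` we have
`B < a_k` for all large `k`, hence `HasSum (i ↦ ĝ(1/2 + iγ^k_i)) (W g)` for all large `k`, and the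
claim follows. No use of RH anywhere (the tree's `windowCompactness_proof` is NOT used).
-/

noncomputable section

set_option linter.dupNamespace false

open Complex Set Filter MeasureTheory
open scoped Topology

namespace Summit.RiemannHypothesis.RiemannHypothesis.Theorems.SpectralTraceWindowStep

open Literature.NumberTheory.LFunctions
open Summit.RiemannHypothesis.RiemannHypothesis.Theorems.SpectralThesis.Sketch

/-- Exhausting levels: a sequence `a_k` with `A/2 ≤ a_k < A` and `a_k → A`. [folklore] -/
theorem exists_levels {A : ℝ} (hA : 0 < A) :
    ∃ a : ℕ → ℝ, (∀ k, A / 2 ≤ a k ∧ a k < A) ∧ Tendsto a atTop (𝓝 A) := by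
  refine ⟨fun k => A * (1 - 1 / ((k : ℝ) + 1) / 2), fun k => ?_, ?_⟩
  · have h1 : 0 < 1 / ((k : ℝ) + 1) := by positivity
    have h2 : 1 / ((k : ℝ) + 1) ≤ 1 := by
      rw [div_le_one (by positivity)]
      linarith [(Nat.cast_nonneg k : (0 : ℝ) ≤ k)]
    constructor <;> nlinarith
  · have h0 : Tendsto (fun k : ℕ => 1 / ((k : ℝ) + 1)) atTop (𝓝 0) :=
      tendsto_one_div_add_atTop_nhds_zero_nat
    have := ((h0.div_const 2).const_sub 1).const_mul A
    simpa using this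

/-- **One family below every level (the trace levels are closed under increasing limits, the
compactness half).** If every level `B` with `0 < B < A` carries a real family `γ` reproducing
the Weil functional on the Weil tests supported in `[-B, B]`, then ONE real family does so for
every such level simultaneously: the cell-wise limit (`ClosedLadder.exists_limit_family`) of
witnesses at levels `a_k ↑ A`, all of them families for the fixed window `[-A/2, A/2]`; a test
supported in `[-B, B]`, `B < A`, is served by `γ^k` for all large `k`. [folklore] -/
theorem stub_traceLimit :
    ∀ A : ℝ, 0 < A →
      (∀ B : ℝ, 0 < B → B < A →
        ∃ (ι : Type) (γ : ι → ℝ), ∀ g : ℝ → ℂ, Literature.NumberTheory.LFunctions.IsWeilTest g →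
          tsupport g ⊆ Set.Icc (-B) B →
            HasSum (fun i => Literature.NumberTheory.LFunctions.weilMellin g (1 / 2 + (γ i : ℂ) * Complex.I))
              (Literature.NumberTheory.LFunctions.weilFunctional g)) →
      ∃ (ι : Type) (γ : ι → ℝ), ∀ B : ℝ, 0 < B → B < A →
        ∀ g : ℝ → ℂ, Literature.NumberTheory.LFunctions.IsWeilTest g →
          tsupport g ⊆ Set.Icc (-B) B →
            HasSum (fun i => Literature.NumberTheory.LFunctions.weilMellin g (1 / 2 + (γ i : ℂ) * Complex.I))
              (Literature.NumberTheory.LFunctions.weilFunctional g) := by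
  intro A hA H
  -- exhausting levels `a k ↑ A` with `A/2 ≤ a k < A`, and the families at these levels
  obtain ⟨a, ha, hat⟩ := exists_levels hA
  choose ι γ hγ using fun k : ℕ => H (a k) (by linarith [(ha k).1]) (ha k).2
  -- all of them are families for the fixed window `[-A/2, A/2]`
  have hB : 0 < A / 2 := half_pos hA
  have hγB : ∀ k, ∀ g : ℝ → ℂ, IsWeilTest g → tsupport g ⊆ Icc (-(A / 2)) (A / 2) →
      HasSum (fun i => weilMellin g (1 / 2 + (γ k i : ℂ) * I)) (weilFunctional g) :=
    fun k g hg hgs => hγ k g hg (hgs.trans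
      (Icc_subset_Icc (by linarith [(ha k).1]) (ha k).1))
  -- the cell-wise limit family
  obtain ⟨ι', γ', hlim⟩ := ClosedLadder.exists_limit_family hB γ hγB
  refine ⟨ι', γ', fun B _ hBA g hg hgs => hlim g hg _ ?_⟩
  -- a test supported in `[-B, B]`, `B < A`, is served by `γ k` for all large `k`
  have hevA : ∀ᶠ k in atTop, B < a k := hat.eventually_const_lt hBA
  refine (hevA.mono fun k hk => ?_).filter_mono Nat.hyperfilter_le_atTop
  exact hγ k g hg (hgs.trans (Icc_subset_Icc (by linarith) hk.le))

end Summit.RiemannHypothesis.RiemannHypothesis.Theorems.SpectralTraceWindowStep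

end
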